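import Literature.AlgebraicGeometry.Resolution.AlterationsThreeBlocks
import Literature.AlgebraicGeometry.Resolution.AlterationsEnlargingZ
import HarnessLib

/-!
# De Jong's alteration theorem: the multisection Lemma 4.13, 4.14, and 4.13–4.22 split at 4.14

Topic: `Literature/AlgebraicGeometry/Resolution`. Companion to `AlterationsThreeBlocks.lean`,
which vendors de Jong 1996, 4.13–4.22 — from a pair `(X, Z)` in situation (vi) of 4.12
(`DeJong1996.SituationVI`) to Situation 4.23 (`DeJong1996.SemiStablePair`), using the induction
hypothesis on the base — as ONE named fact `DeJong1996FibrationToSemiStablePair`. This file is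
the first layer of its decomposition along the printed text, cut after 4.14:

> "4.13. Lemma. — Suppose `f : X → Y` is a morphism of projective varieties over an
> algebraically closed field `k` satisfying (vi) a) and b). There exists a divisor `H ⊂ X` such
> that (i) `f|_H : H → Y` is finite and generically etale, and (ii) for all geometric points
> `ȳ ∈ Y` and any irreducible component `C` of `X_ȳ = f⁻¹(ȳ)` we have
> `# sm(X/Y) ∩ C ∩ H ≥ 3`. Here we count the number of points of the underlying set, i.e. not
> with multiplicities." (p. 69)
>
> "4.14. Assume the pair `(X, Z)` satisfies (i)–(v) and (vi) a)–d). We apply 4.13 to the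
> morphism `f : X → Y` of (vi). This gives `H ⊂ X`. It suffices to prove the theorem for the
> pair `(X, Z ∪ H)`, see 4.9. Note that this pair also satisfies (i)–(v), (vi) a)–d) and
> (vi) e) For all geometric points `ȳ` of `Y` and any irreducible component `C` of `X_ȳ` we
> have `# sm(X/Y) ∩ C ∩ Z ≥ 3`." (p. 70)
>
> "4.15. Assume (i)–(v), (vi) a)–e). In the sequel we will consider projective alterations
> `ψ : Y' → Y`, which are generically étale. […] Conditions (i), (iii) and (iv) are all right
> for the pair `(X', Z')`, but (v) may fail, for example if `Y'` is not normal. […] 4.16. Assume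
> (i)–(iv), (vi) a)–e)." (p. 71)

Accordingly this file

* defines property **(vi) e)**, `DeJong1996.HasThreeSmoothPoints f Z`, on geometric fibres
  (`pullback f ȳ` for `ȳ : Spec K → Y`, `K` algebraically closed, as in `IsSemiStableCurve`),
  their irreducible components, and the preimage of the smooth locus `sm(X/Y)` (Mathlib's
  `Scheme.Hom.smoothLocus`, 2.5) and of `Z`, counted by `Set.encard` ("points of the
  underlying set"); proved API: monotonicity in `Z`;
* defines the running hypotheses **(i), (iii), (iv), (vi) a)–d) with the fibration
  `f : X → Y → Spec k` as data**, `DeJong1996.FibredPair f g Z` — WITHOUT (v) `X` normal, which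
  4.15 gives up ("(v) may fail") and 4.16–4.22 no longer assume; proved API: the link with
  `DeJong1996.SituationVI` ((iii)–(v) and `∃ f`, (vi) a)–d)) in both directions, properness,
  `Z` closed and `Z ≠ X`, and service by Thm. 4.1 (`DeJong1996StrongAlgClosed`);
* vendors **Lemma 4.13** (`DeJong1996MultisectionLemma`), **4.14** (`DeJong1996MultisectionReduction`:
  the pair `(X, Z ∪ H)` satisfies (i)–(iv), (vi) a)–e) for the same `f`) and **4.15–4.22**
  (`DeJong1996MultisectionToSemiStablePair`: given Thm. 4.1 with its generically-étale clause in
  dimension `≤ d`, Thm. 4.1 with the clause for a pair with (i), (iii), (iv), (vi) a)–e) of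
  dimension `d + 1` follows from Thm. 4.1 with the clause for all semi-stable pairs
  (Situation 4.23) over `k` of the same dimension) as NAMED FACTS with the source's numbering;
* PROVES the assembly `DeJong1996FibrationToSemiStablePair.of_multisection_of_toSemiStablePair`
  (4.14, then 4.9 = `DeJong1996.ConclusionGenericallyEtale.of_subset`, then 4.15–4.22) and its
  composites `DeJong1996NormalProjectiveStepVI.of_multisection_of_toSemiStablePair_of_resolution`,
  `DeJong1996StrongAlgClosed.…`, `DeJong1996Strong.…`; and the sanity implications
  `DeJong1996StrongAlgClosed → DeJong1996MultisectionToSemiStablePair`,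
  `DeJong1996StrongAlgClosed → DeJong1996FibrationToSemiStablePair`.

`DeJong1996MultisectionReduction` IS proved from `DeJong1996MultisectionLemma` downstream
(`DeJong1996MultisectionReduction.of_multisectionLemma`, file `AlterationsMultisectionProofs`: the
bookkeeping "`f|_{Z ∪ H}` is finite and generically étale when `f|_Z` and `f|_H` are" is
`DeJong1996.IsFiniteGenericallyEtaleOn.union`, by Zariski's Main Theorem and a comparison of the
reduced induced structures on `Z ⊆ Z ∪ H` away from `cl(H ∖ Z)`; (iv) for `Z ∪ H` is
`IsEffectiveCartier.mul` with `Scheme.IdealSheafData.support_mul`; (vi) e) for `Z ∪ H` is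
`HasThreeSmoothPoints.mono`), and `DeJong1996MultisectionLemma` is proved from the single open
leaf of its printed proof, the hyperplane section at a closed point
(`DeJong1996MultisectionHyperplane`, file `AlterationsMultisectionLocalStep`), by
`DeJong1996MultisectionLemma.of_hyperplane` (file `AlterationsMultisectionEtaleNhdProofs`; the
Noetherian induction `DeJong1996MultisectionLemma.of_local`, the étale neighbourhood
`DeJong1996MultisectionEtaleNhd_holds` and the generic étaleness
`DeJong1996MultisectionGenericallyEtale_holds` are all proved) — see the Status paragraphs of the
two facts below. `DeJong1996MultisectionToSemiStablePair` is decomposed further downstream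
(4.15–4.17: Galois normalisation and the projective level-`ℓ` moduli scheme of stable `n`-pointed
curves 2.24, reaching (vi) f), g); 4.18–4.21: flattening 2.19 and the three-point Lemma 4.20;
4.22: the induction hypothesis on `(Y, D)` and base change; assembled in
`DeJong1996FibrationToSemiStablePair.of_printedLeaves`, file `AlterationsStrongAlgClosedLeaves`).

## Sources

* A. J. de Jong, *Smoothness, semi-stability and alterations*, Publ. Math. IHÉS 83 (1996) 51–93:
  2.2, 2.3, 2.5, 2.6 (pp. 54–55), 2.20, 2.24 (pp. 61–62), Thm. 4.1, 4.4, 4.9 (pp. 66–67), 4.12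
  (vi) (p. 69), Lemma 4.13 (pp. 69–70), 4.14 (p. 70), 4.15–4.22 (pp. 71–75), 4.23 (p. 75).
-/

noncomputable section

open CategoryTheory CategoryTheory.Limits AlgebraicGeometry TopologicalSpace Topology

namespace Literature.AlgebraicGeometry.Resolution

universe u

namespace DeJong1996

/-! ## Property (vi) e) -/

/-- **de Jong 1996, 4.14 (vi) e)** (also Lemma 4.13 (ii) and 4.18 e)) for a morphism
`f : X → Y` and a subset `Z ⊆ X`: "For all geometric points `ȳ` of `Y` and any irreducible
component `C` of `X_ȳ` we have `# sm(X/Y) ∩ C ∩ Z ≥ 3`." — "Here we count the number of points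
of the underlying set, i.e. not with multiplicities" (4.13). Rendered: for every algebraically
closed field `K` and every `ȳ : Spec K → Y`, every irreducible component `C` of the geometric
fibre `X_ȳ = X ×_Y Spec K` (Mathlib's `pullback f ȳ`) contains at least `3` points (of the
underlying set of `X_ȳ`, counted with `Set.encard`) whose image under the projection
`X_ȳ → X` lies in the smooth locus `sm(X/Y)` of `f` (2.5; Mathlib's `Scheme.Hom.smoothLocus`,
which needs `f` locally of finite presentation — automatic for a morphism of varieties) and in
`Z`. [cite: DeJong1996, 4.14 (vi) e), p. 70] -/
def HasThreeSmoothPoints {X Y : Scheme.{u}} (f : X ⟶ Y) [LocallyOfFinitePresentation f]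
    (Z : Set X) : Prop :=
  ∀ (K : Type u) [Field K] [IsAlgClosed K] (y : Spec (.of K) ⟶ Y),
    ∀ C ∈ irreducibleComponents ↥(pullback f y),
      3 ≤ (C ∩ (pullback.fst f y) ⁻¹' ((f.smoothLocus : Set X) ∩ Z)).encard

namespace HasThreeSmoothPoints

variable {X Y : Scheme.{u}} {f : X ⟶ Y} [LocallyOfFinitePresentation f] {Z Z' : Set X}

/-- (vi) e) is monotone in `Z` (used in 4.14: `Z ∪ H` inherits it from `H`). [folklore] -/
theorem mono (hZ : Z ⊆ Z') (h : HasThreeSmoothPoints f Z) : HasThreeSmoothPoints f Z' :=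
  fun K _ _ y C hC => (h K y C hC).trans (Set.encard_le_encard (Set.inter_subset_inter_right _
    (Set.preimage_mono (Set.inter_subset_inter_right _ hZ))))

/-- In particular `Z ∪ H` has (vi) e) as soon as `Z` has. [folklore] -/
theorem union_left (H : Set X) (h : HasThreeSmoothPoints f Z) : HasThreeSmoothPoints f (Z ∪ H) :=
  h.mono Set.subset_union_left

/-- In particular `Z ∪ H` has (vi) e) as soon as `H` has. [folklore] -/
theorem union_right (Z : Set X) {H : Set X} (h : HasThreeSmoothPoints f H) :
    HasThreeSmoothPoints f (Z ∪ H) :=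
  h.mono Set.subset_union_right

end HasThreeSmoothPoints

/-! ## (i), (iii), (iv), (vi) a)–d) with the fibration as data -/

/-- **The running hypotheses of de Jong 1996, 4.14–4.22 on the pair `(X, Z)`, with the fibration
`f : X → Y` of (vi) as data** (over the ambient field `k`, algebraically closed in the text, (i)):
`X` is a variety (2.9: integral) with "(iii) `X` is projective" (over `k`, via `f ≫ g`), "(iv)
There exists a divisor `D ⊂ X` such that `Z` is the support of `D`" (2.3: an effective Cartier
divisor, `IsEffectiveCartier`), `Y` is a projective variety over `k` (integral — an instance
argument, so that the generic fibre of `f` makes sense — and projective via `g`), and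
`f : X → Y` satisfies "(vi) a) All fibres are nonempty, geometrically connected and
equidimensional of dimension 1. (vi) b) The smooth locus of `f` is dense in all fibres. (vi) c)
The generic fibre of `f` is smooth" (`IsCurveFibration f`) and "(vi) d) The morphism
`f|_Z : Z → Y` is finite and generically etale" (`IsFiniteGenericallyEtaleOn f Z`, `Z` with its
reduced closed subscheme structure, 2.2). Hypothesis (v) "`X` is a normal variety" is NOT part
of the structure: 4.15 gives it up ("Conditions (i), (iii) and (iv) are all right for the pair
`(X', Z')`, but (v) may fail") and 4.16–4.22 assume "(i)–(iv), (vi) a)–e)" only; with (v) and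
`∃ f` this is `SituationVI` (`FibredPair.situationVI`, `SituationVI.exists_fibredPair`).
[cite: DeJong1996, 4.12 (vi) and 4.14–4.16, pp. 69–71] -/
structure FibredPair {k : Type u} [Field k] {X Y : Scheme.{u}} [IsIntegral Y] (f : X ⟶ Y)
    (g : Y ⟶ Spec (.of k)) (Z : Set X) : Prop where
  /-- `X` is integral (a variety, 2.9) -/
  isIntegral : IsIntegral X
  /-- (iii) `X` is projective over `k` -/
  isProjectiveOver : Literature.AlgebraicGeometry.Motives.IsProjectiveOver (Over.mk (f ≫ g))
  /-- (iv) `Z` is the support of an effective Cartier divisor of `X` -/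
  exists_isEffectiveCartier :
    ∃ I : X.IdealSheafData, IsEffectiveCartier I ∧ (I.support : Set X) = Z
  /-- `Y` is projective over `k` -/
  isProjectiveOver_base : Literature.AlgebraicGeometry.Motives.IsProjectiveOver (Over.mk g)
  /-- (vi) a), b), c) for `f` -/
  isCurveFibration : IsCurveFibration f
  /-- (vi) d): `f|_Z : Z → Y` is finite and generically étale -/
  isFiniteGenericallyEtaleOn : IsFiniteGenericallyEtaleOn f Z

namespace FibredPair

variable {k : Type u} [Field k] {X Y : Scheme.{u}} [IsIntegral Y] {f : X ⟶ Y}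
  {g : Y ⟶ Spec (.of k)} {Z : Set X}

/-- `X → Spec k` is proper. [folklore] -/
theorem isProper (h : FibredPair f g Z) : IsProper (f ≫ g) :=
  Literature.AlgebraicGeometry.Motives.IsProjectiveOver.isProper (X := Over.mk (f ≫ g))
    h.isProjectiveOver

/-- `X → Spec k` is separated. [folklore] -/
theorem isSeparated (h : FibredPair f g Z) : IsSeparated (f ≫ g) :=
  haveI := h.isProper
  inferInstance

/-- `X → Spec k` is locally of finite type. [folklore] -/
theorem locallyOfFiniteType (h : FibredPair f g Z) : LocallyOfFiniteType (f ≫ g) :=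
  haveI := h.isProper
  inferInstance

/-- `X → Spec k` is quasi-compact. [folklore] -/
theorem quasiCompact (h : FibredPair f g Z) : QuasiCompact (f ≫ g) :=
  haveI := h.isProper
  inferInstance

/-- `f` is locally of finite presentation (recorded in (vi) a)–c)). [folklore] -/
theorem locallyOfFinitePresentation (h : FibredPair f g Z) : LocallyOfFinitePresentation f :=
  h.isCurveFibration.locallyOfFinitePresentation

/-- The support of a divisor is closed. [folklore] -/
theorem isClosed (h : FibredPair f g Z) : IsClosed Z := by
  obtain ⟨I, -, hI⟩ := h.exists_isEffectiveCartier
  rw [← hI]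
  exact I.support.isClosed

/-- The support of a divisor on a variety is a proper subset (it misses the generic point,
`NormalProjectivePair.genericPoint_notMem_support`). [folklore] -/
theorem ne_univ (h : FibredPair f g Z) : Z ≠ Set.univ := by
  haveI := h.isIntegral
  obtain ⟨I, hI, hIZ⟩ := h.exists_isEffectiveCartier
  intro hZ
  have := NormalProjectivePair.genericPoint_notMem_support hI
  rw [hIZ, hZ] at this
  exact this (Set.mem_univ _)

/-- With (v) `X` normal, a fibred pair is a pair in situation (vi) of 4.12 (`SituationVI`) for
`X → Spec k` the composite `f ≫ g`. [cite: DeJong1996, 4.12 (vi), p. 69] -/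
theorem situationVI (h : FibredPair f g Z)
    (hv : ∀ x : X, IsIntegrallyClosed (X.presheaf.stalk x)) : SituationVI (f ≫ g) Z where
  normalProjectivePair :=
    { isIntegral := h.isIntegral
      isProjectiveOver := h.isProjectiveOver
      exists_isEffectiveCartier := h.exists_isEffectiveCartier
      isIntegrallyClosed := hv }
  exists_isCurveFibration := ⟨Y, ‹_›, g, f, h.isProjectiveOver_base, rfl, h.isCurveFibration,
    h.isFiniteGenericallyEtaleOn⟩

/-- A fibred pair is a pair as in Thm. 4.1 (`X` a variety over `k`, `Z ⊂ X` a proper closed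
subset), so Thm. 4.1 with its generically-étale clause over algebraically closed fields
(`DeJong1996StrongAlgClosed`) serves it. [folklore] -/
theorem conclusionGenericallyEtale_of_strongAlgClosed [IsAlgClosed k] (h : FibredPair f g Z)
    (H : DeJong1996StrongAlgClosed.{u}) : ConclusionGenericallyEtale (f ≫ g) Z :=
  H k X (f ≫ g) Z h.isSeparated h.locallyOfFiniteType h.quasiCompact h.isIntegral h.isClosed
    h.ne_univ

end FibredPair

/-- A pair in situation (vi) of 4.12 is a fibred pair for some fibration `f : X → Y` over `k`
with `f ≫ g = (X → Spec k)` (and (v) holds). [cite: DeJong1996, 4.12 (vi), p. 69] -/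
theorem SituationVI.exists_fibredPair {k : Type u} [Field k] {X : Scheme.{u}}
    {fX : X ⟶ Spec (.of k)} {Z : Set X} (h : SituationVI fX Z) :
    ∃ (Y : Scheme.{u}) (_ : IsIntegral Y) (g : Y ⟶ Spec (.of k)) (f : X ⟶ Y),
      f ≫ g = fX ∧ FibredPair f g Z := by
  obtain ⟨Y, hY, g, f, hproj, hfg, hcf, hfin⟩ := h.exists_isCurveFibration
  subst hfg
  exact ⟨Y, hY, g, f, rfl,
    { isIntegral := h.normalProjectivePair.isIntegral
      isProjectiveOver := h.normalProjectivePair.isProjectiveOver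
      exists_isEffectiveCartier := h.normalProjectivePair.exists_isEffectiveCartier
      isProjectiveOver_base := hproj
      isCurveFibration := hcf
      isFiniteGenericallyEtaleOn := hfin }⟩

end DeJong1996

/-! ## Lemma 4.13, 4.14 and 4.15–4.22 as named facts -/

/-- NAMED FACT — **de Jong 1996, Lemma 4.13 (the multisection lemma).** "Suppose `f : X → Y` is
a morphism of projective varieties over an algebraically closed field `k` satisfying (vi) a) and
b) [(vi) a) All fibres are nonempty, geometrically connected and equidimensional of dimension 1.
(vi) b) The smooth locus of `f` is dense in all fibres]. There exists a divisor `H ⊂ X` such that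
(i) `f|_H : H → Y` is finite and generically etale, and (ii) for all geometric points `ȳ ∈ Y`
and any irreducible component `C` of `X_ȳ = f⁻¹(ȳ)` we have `# sm(X/Y) ∩ C ∩ H ≥ 3`. Here we
count the number of points of the underlying set, i.e. not with multiplicities." Rendered with
`X`, `Y` integral and projective over `k` (via `f ≫ g` and `g`), `f` locally of finite
presentation (automatic; needed to speak of `sm(X/Y)`), (vi) a), b) as in `IsCurveFibration`
(scheme-theoretic fibres `f.fiber y` at all points, `GeometricallyConnected`, every irreducible
component of every fibre of dimension `1`, the preimage of `f.smoothLocus` dense in every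
fibre); the divisor `H` (2.3) is delivered as the support of an effective Cartier divisor
(`IsEffectiveCartier`), with (i) for its reduced closed subscheme structure (2.2,
`IsFiniteGenericallyEtaleOn f H` — the form in which 4.14 uses it for `Z ∪ H`) and (ii) =
`HasThreeSmoothPoints f H`. Inputs of the printed proof: a very ample `ℒ` and the embedding by
`ℒ^{⊗n}`, the incidence variety `T ⊂ 𝐏^∨ × Y` of hyperplanes containing a fibre component and
its dimension count (2.7), transversality on one fibre, "finite étale over a neighbourhood of
`y`", and Noetherian induction on `Y` taking unions `H ∪ H'`. Users take
`(h : DeJong1996MultisectionLemma)`.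

Status (split review, D-0026): NOT to be split again and needing no new named fact — the printed
proof is in the tree with every piece of glue proved: the Noetherian induction
(`DeJong1996MultisectionLemma.of_local`, file `AlterationsMultisectionLocal`), the local step from
its three printed inputs
(`DeJong1996MultisectionLocal.of_hyperplane_of_etaleNhd_of_genericallyEtale`, file
`AlterationsMultisectionLocalStep`), and two of those inputs outright
(`DeJong1996MultisectionEtaleNhd_holds`, `DeJong1996MultisectionGenericallyEtale_holds`). The one
open leaf is the hyperplane section at a closed point, `DeJong1996MultisectionHyperplane` (proof
of Lemma 4.13, pp. 69–70: the embedding by `ℒ^{⊗n}`, the incidence variety `T` with 2.7, Bertini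
on one fibre, `deg G ≥ n`), and the discharge `DeJong1996MultisectionLemma_holds` is the term
`DeJong1996MultisectionLemma.of_hyperplane DeJong1996MultisectionHyperplane_holds` (file
`AlterationsMultisectionEtaleNhdProofs`) once that leaf lands.
[cite: DeJong1996, Lemma 4.13, pp. 69–70] -/
def DeJong1996MultisectionLemma : Prop :=
  ∀ (k : Type u) [Field k] [IsAlgClosed k] (X Y : Scheme.{u}) [IsIntegral X] [IsIntegral Y]
    (f : X ⟶ Y) [LocallyOfFinitePresentation f] (g : Y ⟶ Spec (.of k)),
    Literature.AlgebraicGeometry.Motives.IsProjectiveOver (Over.mk (f ≫ g)) →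
      Literature.AlgebraicGeometry.Motives.IsProjectiveOver (Over.mk g) →
        Surjective f → GeometricallyConnected f →
          (∀ (y : Y), ∀ C ∈ irreducibleComponents ↥(f.fiber y), topologicalKrullDim ↥C = 1) →
            (∀ y : Y, Dense ((f.fiberι y) ⁻¹' (f.smoothLocus : Set X))) →
              ∃ H : Set X,
                (∃ I : X.IdealSheafData, IsEffectiveCartier I ∧ (I.support : Set X) = H) ∧
                  DeJong1996.IsFiniteGenericallyEtaleOn f H ∧ DeJong1996.HasThreeSmoothPoints f H

/-- NAMED FACT — **de Jong 1996, 4.14: adjoining a multisection to `Z`.** "Assume the pair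
`(X, Z)` satisfies (i)–(v) and (vi) a)–d). We apply 4.13 to the morphism `f : X → Y` of (vi).
This gives `H ⊂ X`. It suffices to prove the theorem for the pair `(X, Z ∪ H)`, see 4.9. Note
that this pair also satisfies (i)–(v), (vi) a)–d) and (vi) e) For all geometric points `ȳ` of
`Y` and any irreducible component `C` of `X_ȳ` we have `# sm(X/Y) ∩ C ∩ Z ≥ 3`." Vendored as the
printed construction: over an algebraically closed `k`, for a fibred pair `(X, Z)` with
`f : X → Y` ((i), (iii), (iv), (vi) a)–d): `DeJong1996.FibredPair f g Z`) and (v) `X` normal,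
there is `H ⊆ X` such that `(X, Z ∪ H)` is again a fibred pair for the same `f` ((iv): `Z ∪ H`
is the support of the product of the two divisors; (vi) d) for `Z ∪ H`) and has (vi) e)
(`DeJong1996.HasThreeSmoothPoints f (Z ∪ H)`); the sufficiency "see 4.9" is the proved
`DeJong1996.ConclusionGenericallyEtale.of_subset`. Users take
`(h : DeJong1996MultisectionReduction)`; it follows from `DeJong1996MultisectionLemma`
(`DeJong1996MultisectionReduction.of_multisectionLemma`, file `AlterationsMultisectionProofs`;
hypothesis (v) is not used).

Status (split review, D-0026): NOT to be split again, not to be restated (it is 4.14 as printed),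
and needing no new named fact — its content beyond Lemma 4.13 (the bookkeeping "this pair also
satisfies (i)–(v), (vi) a)–d)") is proved, and through the Status of `DeJong1996MultisectionLemma`
it is closed modulo the single open leaf `DeJong1996MultisectionHyperplane` (file
`AlterationsMultisectionLocalStep`): the discharge `DeJong1996MultisectionReduction_holds` is the
term `DeJong1996MultisectionReduction.of_multisectionLemma
(DeJong1996MultisectionLemma.of_hyperplane DeJong1996MultisectionHyperplane_holds)`, in a file
importing `AlterationsMultisectionEtaleNhdProofs`, once that leaf lands; a seat holding 4.14
either takes that existing leaf (`ledger fact claim`) or parks on it (`blocked-on`).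
[cite: DeJong1996, 4.14, p. 70] -/
def DeJong1996MultisectionReduction : Prop :=
  ∀ (k : Type u) [Field k] [IsAlgClosed k] (X Y : Scheme.{u}) [IsIntegral Y] (f : X ⟶ Y)
    [LocallyOfFinitePresentation f] (g : Y ⟶ Spec (.of k)) (Z : Set X),
    DeJong1996.FibredPair f g Z → (∀ x : X, IsIntegrallyClosed (X.presheaf.stalk x)) →
      ∃ H : Set X, DeJong1996.FibredPair f g (Z ∪ H) ∧ DeJong1996.HasThreeSmoothPoints f (Z ∪ H)

/-- NAMED FACT — **de Jong 1996, 4.15–4.22: from a fibred pair with (vi) e) to a semi-stable pair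
(Situation 4.23), using the induction hypothesis on the base.** Over an algebraically closed
field `k`, assume Thm. 4.1 with its generically-étale clause for all pairs over `k` of dimension
`≤ d` (`DeJong1996.StatementUpToDim k d`), and let `(X, Z)` with `f : X → Y → Spec k` satisfy
(i), (iii), (iv), (vi) a)–d) (`DeJong1996.FibredPair f g Z`) and (vi) e)
(`DeJong1996.HasThreeSmoothPoints f Z`), with `dim X = d + 1` ("4.16. Assume (i)–(iv), (vi)
a)–e)"). Then Thm. 4.1 with the clause for `(X → Spec k, Z)` follows from Thm. 4.1 with the
clause for every pair `(X', Z')` in Situation 4.23 over `k` (`DeJong1996.SemiStablePair`,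
`Z' = ⋃ᵢ τᵢ(Y') ∪ f'⁻¹(D')`) with `dim X' = dim X`. This is the content of 4.15 (for a generically
étale projective alteration `ψ : Y' → Y`, the strict transform `X' = (Y' ×_Y X)_red → Y'`, 2.18,
2.20, with `Z' = pr⁻¹(Z)` keeps (i), (iii), (iv), (vi) a)–e), and `φ : X' → X` "is a projective
alteration which is generically étale … it suffices to prove the theorem for the pair
`(X', Z')`", 4.4), 4.16 (`Y' =` the normalisation of `Y` in a finite Galois extension
`L ⊇ k(Zᵢ)` of `k(Y)`, possible by (vi) d): "(vi) f) There are sections `σᵢ : Y → X`,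
`i = 1, …, n` of `f` such that `Z = ⋃ σᵢ(Y)`"), 4.17 (`U = {y ∈ Y | X_y` is smooth over `y` and
`σᵢ(y) ≠ σⱼ(y)` for `i ≠ j} ≠ ∅` by (vi) c); `n ≥ 3` by (vi) e), so `(X_U, σ₁|_U, …, σₙ|_U)` is
a stable `n`-pointed curve of genus `g` over `U`; with `ℓ ≥ 3` prime to `char k`, `Y' =` the
closure of a component `U'` of `U ×_{M_{g,n}} ℓM_{g,n}` in `Y × ℓM̄_{g,n}`, a projective variety,
`Y' → Y` a generically étale alteration, over which the curve extends, 2.24: "(vi) g) There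
exist a stable `n`-pointed curve `(𝒞, τ₁, …, τₙ)` over `Y`, a nonempty open subscheme `U ⊂ Y`
and an isomorphism `β : 𝒞_U → X_U` mapping the section `τᵢ|_U` to the section `σᵢ|_U`"),
4.18–4.21 (for `f : X → S` proper of integral excellent schemes with sections and a)–c), e),
g): flattening 2.19 of `X` and of the closure `T ⊂ 𝒞 ×_S X` of `Γ_β` by a modification of `S`,
normalisation of `S`, the three-point Lemma 4.20, and Serre's criterion for `𝒞`: "the rational
map `β` extends to a birational morphism `β : 𝒞 → X`, at least after replacing `S` by a
modification and `𝒞` and `X` by their strict transforms"), and 4.22 ("we find a modification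
`ψ : Y' → Y`, such that `β'` extends. Once again using 4.15 we may replace `Y` by `Y'` […]
there is a closed subset `D ⊂ Y` such that we have `β⁻¹(Z) ⊂ τ₁(Y) ∪ … ∪ τₙ(Y) ∪ f⁻¹(D)` and
such that `𝒞 → Y` is smooth over `Y ∖ D`. We replace `X` by `𝒞` and `Z` by
`τ₁(Y) ∪ … ∪ τₙ(Y) ∪ f⁻¹(D)`, see 4.4 and 4.9. At this point we apply the induction hypothesis:
there exists a nonsingular projective variety `Y'` and a generically étale alteration
`ψ : Y' → Y` such that the closed subset `ψ⁻¹(D)` is a strict normal crossings divisor on `Y`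
[`dim Y = dim X - 1 = d`]. Pulling back the family `𝒞` to a family `𝒳` over `Y'` and applying
4.4 once again, we reduce to the situation described in 4.23 below. (We drop the stability
hypothesis, since we will not need it any more.)"). Every replacement of `(X, Z)` is an
enlargement of `Z` (4.9, `DeJong1996.ConclusionGenericallyEtale.of_subset`) or is along a
generically étale alteration (4.4, `DeJong1996.ConclusionGenericallyEtale.of_isAlteration`),
which preserves `dim X` (2.20, `IsAlteration.topologicalKrullDim_eq`). Users take
`(h : DeJong1996MultisectionToSemiStablePair)`; it is the node to decompose further (next
notions: sections (vi) f), stable `n`-pointed curves 2.24 and (vi) g), strict transforms 2.18).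
[cite: DeJong1996, 4.15–4.22, pp. 71–75] -/
def DeJong1996MultisectionToSemiStablePair : Prop :=
  ∀ (k : Type u) [Field k] [IsAlgClosed k] (d : ℕ), DeJong1996.StatementUpToDim k d →
    ∀ (X Y : Scheme.{u}) [IsIntegral Y] (f : X ⟶ Y) [LocallyOfFinitePresentation f]
      (g : Y ⟶ Spec (.of k)) (Z : Set X),
      DeJong1996.FibredPair f g Z → DeJong1996.HasThreeSmoothPoints f Z →
        topologicalKrullDim X = (d + 1 : ℕ) →
          (∀ (X' Y' : Scheme.{u}) (f' : X' ⟶ Y') (g' : Y' ⟶ Spec (.of k)) (D' : Set Y') (n : ℕ)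
              (τ : Fin n → (Y' ⟶ X')), DeJong1996.SemiStablePair f' g' D' τ →
              topologicalKrullDim X' = topologicalKrullDim X →
                DeJong1996.ConclusionGenericallyEtale (f' ≫ g')
                  (DeJong1996.semiStableBoundary f' D' τ)) →
            DeJong1996.ConclusionGenericallyEtale (f ≫ g) Z

/-! ## The assembly -/

/-- **4.13–4.22 from 4.14 and 4.15–4.22**: given a pair in situation (vi) (`SituationVI`: (v) and
a fibration `f` with (vi) a)–d)), adjoin the multisection of 4.14 (`DeJong1996MultisectionReduction`:
`(X, Z ∪ H)` is a fibred pair with (vi) e)), note that "It suffices to prove the theorem for the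
pair `(X, Z ∪ H)`, see 4.9" (`DeJong1996.ConclusionGenericallyEtale.of_subset`, `Z` being the
support of a divisor on the proper `X`), and run 4.15–4.22
(`DeJong1996MultisectionToSemiStablePair`). [cite: DeJong1996, 4.14, p. 70] -/
theorem DeJong1996FibrationToSemiStablePair.of_multisection_of_toSemiStablePair
    (h14 : DeJong1996MultisectionReduction.{u}) (h15 : DeJong1996MultisectionToSemiStablePair.{u}) :
    DeJong1996FibrationToSemiStablePair.{u} := by
  intro k _ _ d ih X fX Z hVI hdim hS
  obtain ⟨Y, hY, g, f, hfg, hP⟩ := hVI.exists_fibredPair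
  subst hfg
  haveI := hP.isIntegral
  haveI := hP.isProper
  haveI := hP.locallyOfFinitePresentation
  obtain ⟨H, hP', h3⟩ := h14 k X Y f g Z hP hVI.normalProjectivePair.isIntegrallyClosed
  exact DeJong1996.ConclusionGenericallyEtale.of_subset Set.subset_union_left
    hP.exists_isEffectiveCartier (h15 k d ih X Y f g (Z ∪ H) hP' h3 hdim hS)

/-- **`DeJong1996NormalProjectiveStepVI` (4.13–4.28) from three named inputs**: 4.14
(`DeJong1996MultisectionReduction`), 4.15–4.22 (`DeJong1996MultisectionToSemiStablePair`) and
4.23–4.28 (`DeJong1996SemiStablePairResolution`). [cite: DeJong1996, 4.13–4.28, pp. 69–76] -/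
theorem DeJong1996NormalProjectiveStepVI.of_multisection_of_toSemiStablePair_of_resolution
    (h14 : DeJong1996MultisectionReduction.{u}) (h15 : DeJong1996MultisectionToSemiStablePair.{u})
    (hres : DeJong1996SemiStablePairResolution.{u}) : DeJong1996NormalProjectiveStepVI.{u} :=
  DeJong1996NormalProjectiveStepVI.of_fibrationToSemiStablePair_of_resolution
    (DeJong1996FibrationToSemiStablePair.of_multisection_of_toSemiStablePair h14 h15) hres

/-- Sanity of the cut: 4.15–4.22 in the vendored form is a special case of Thm. 4.1 over
algebraically closed fields (`DeJong1996.FibredPair.conclusionGenericallyEtale_of_strongAlgClosed`).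
[folklore] -/
theorem DeJong1996MultisectionToSemiStablePair.of_strongAlgClosed
    (H : DeJong1996StrongAlgClosed.{u}) : DeJong1996MultisectionToSemiStablePair.{u} :=
  fun _ _ _ _ _ _ _ _ _ _ _ _ hP _ _ _ => hP.conclusionGenericallyEtale_of_strongAlgClosed H

/-- Sanity of the cut: Thm. 4.1 over algebraically closed fields gives 4.13–4.22 outright, a pair
in situation (vi) being a fibred pair (`DeJong1996.SituationVI.exists_fibredPair`), hence a pair
as in Thm. 4.1. [folklore] -/
theorem DeJong1996FibrationToSemiStablePair.of_strongAlgClosed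
    (H : DeJong1996StrongAlgClosed.{u}) : DeJong1996FibrationToSemiStablePair.{u} := by
  intro k _ _ d _ X fX Z hVI _ _
  obtain ⟨Y, hY, g, f, hfg, hP⟩ := hVI.exists_fibredPair
  subst hfg
  exact hP.conclusionGenericallyEtale_of_strongAlgClosed H

/-- The induction step 4.6–4.28 (`DeJong1996InductionStep`) from the four live nodes 4.11–4.12,
4.14, 4.15–4.22, 4.23–4.28. [cite: DeJong1996, 4.6–4.28, pp. 66–76] -/
theorem DeJong1996InductionStep.of_fourBlocks
    (h₁ : DeJong1996FibrationReduction.{u}) (h14 : DeJong1996MultisectionReduction.{u})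
    (h15 : DeJong1996MultisectionToSemiStablePair.{u}) (hres : DeJong1996SemiStablePairResolution.{u}) :
    DeJong1996InductionStep.{u} :=
  DeJong1996InductionStep.of_step (DeJong1996NormalProjectiveStep.of_threeBlocks h₁
    (DeJong1996FibrationToSemiStablePair.of_multisection_of_toSemiStablePair h14 h15) hres)

/-- **Thm. 4.1 with its generically-étale clause over algebraically closed fields
(`DeJong1996StrongAlgClosed`) from the four live nodes** `DeJong1996FibrationReduction`
(4.11–4.12), `DeJong1996MultisectionReduction` (4.14), `DeJong1996MultisectionToSemiStablePair`
(4.15–4.22) and `DeJong1996SemiStablePairResolution` (4.23–4.28).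
[cite: DeJong1996, 4.3–4.28, pp. 66–76] -/
theorem DeJong1996StrongAlgClosed.of_fourBlocks
    (h₁ : DeJong1996FibrationReduction.{u}) (h14 : DeJong1996MultisectionReduction.{u})
    (h15 : DeJong1996MultisectionToSemiStablePair.{u}) (hres : DeJong1996SemiStablePairResolution.{u}) :
    DeJong1996StrongAlgClosed.{u} :=
  DeJong1996StrongAlgClosed.of_threeBlocks h₁
    (DeJong1996FibrationToSemiStablePair.of_multisection_of_toSemiStablePair h14 h15) hres

/-- **Thm. 4.1 (i)+(ii) and its last sentence from the five live nodes**: the limit argument of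
4.5 (`DeJong1996.FiniteSubextension45`), 4.11–4.12, 4.14, 4.15–4.22 and 4.23–4.28.
[cite: DeJong1996, Thm. 4.1, p. 66] -/
theorem DeJong1996Strong.of_finiteSubextension45_of_fourBlocks
    (H : DeJong1996.FiniteSubextension45.{u}) (h₁ : DeJong1996FibrationReduction.{u})
    (h14 : DeJong1996MultisectionReduction.{u}) (h15 : DeJong1996MultisectionToSemiStablePair.{u})
    (hres : DeJong1996SemiStablePairResolution.{u}) :
    DeJong1996Strong.{u} ∧ DeJong1996StrongPerfect.{u} :=
  DeJong1996Strong.of_finiteSubextension45_of_threeBlocks H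
    h₁ (DeJong1996FibrationToSemiStablePair.of_multisection_of_toSemiStablePair h14 h15) hres

/-- Thm. 4.1 (i)+(ii) over every field from 4.5 (`DeJong1996Descent`) and the four live nodes.
[cite: DeJong1996, 4.3–4.28, pp. 66–76] -/
theorem DeJong1996Strong.of_descent_of_fourBlocks
    (h45 : DeJong1996Descent.{u}) (h₁ : DeJong1996FibrationReduction.{u})
    (h14 : DeJong1996MultisectionReduction.{u}) (h15 : DeJong1996MultisectionToSemiStablePair.{u})
    (hres : DeJong1996SemiStablePairResolution.{u}) : DeJong1996Strong.{u} :=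
  DeJong1996Strong.of_descent_of_threeBlocks h45 h₁
    (DeJong1996FibrationToSemiStablePair.of_multisection_of_toSemiStablePair h14 h15) hres

end Literature.AlgebraicGeometry.Resolution

end
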